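import Summits.BirchSwinnertonDyer.Rank1Residual.WAll.TargetAdditive
import Summits.BirchSwinnertonDyer.Rank1Residual.WAll.AltClosersGlue
import Summits.BirchSwinnertonDyer.Rank1Residual.Additive.X4RankZeroCoveredLocusFiveLeNoLemma20
import HarnessLib

/-!
# Rung W-ALL (D-0120): ALT-CLOSERS BY NAME for the SIX CELL SUB-`Prop`s of row 2 (additive primes)
# and the rank / prime slices the wall's planners type as residuals (cell `bsd-wall`, lane 2, seat ty-2)

HONEST FRAMING (cell `bsd-wall`, run/shared/lean/pub/bsd-wall/; WALL-BRIEF-v1 §2; companion of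
`WAll/AltClosers.lean`, `WAll/AltClosersAdditive.lean`, `WAll/AltClosersGlue.lean`, same rules:
NOTHING ASSERTED, no `def`, no `@[conjecture]`, no named fact, no route file imported). Seat ty-1's
`WAll/TargetAdditive.lean` (p489759) refines row 2 of the closed list, `WAllExclAdditive` (non-CM,
`p` odd additive, `r ≤ 1` ⇒ `BSD(E,p)`), along the tree's sub-partition of the odd additive locus
(`Additive.addv_odd_cells`) into SIX sub-`Prop`s — WALL-TABLE / CENSUS-EXCLUSIONS-v1 §3 sub-rows
2e ↦ `WAllExclAddPotMult` (cell (M)), 2a ↦ `WAllExclAddPotOrd` ((G-ord)), 2b ↦ `WAllExclAddGss` and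
2c ↦ `WAllExclAddTprime` (together `WAllExclAddTameSS` = class O5), 2d ↦ `WAllExclAddWild` (class O6,
`p = 3`) — and proves `wAllExclAdditive_iff_cells`. This file closes EACH sub-`Prop`, in exactly
ty-1's shape, from the REGISTERED RUNG LEAVES of LADDER-BSD §1c by name:

| sub-row | sub-`Prop` (`Summit.BirchSwinnertonDyer.…`) | closer (this file) | closes from |
|---|---|---|---|
| 2b | `WAllExclAddGss` | `wallExclAddGss_of_o5SharpGss` | LEAF K8 `Additive.O5SharpGss` + GZK |
| 2c | `WAllExclAddTprime` | `wallExclAddTprime_of_o5SharpTprime` | LEAF K9-tame `Additive.O5SharpTprime` + GZK |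
| 2b ∪ 2c | `WAllExclAddTameSS` | `wallExclAddTameSS_of_sharpLeaves` | K8 + K9-tame + GZK |
| 2d | `WAllExclAddWild` | `wallExclAddWild_of_o6Sharp` | LEAF K9-wild `Additive.O6Sharp` + GZK |
| 2a | `WAllExclAddPotOrd` | `wallExclAddPotOrd_of_lowerHalf_of_upperHalf` | LEAF K1 `Additive.AdditiveOrdinaryLowerHalf` + OPEN `hUpG` + GZK |
| 2e | `WAllExclAddPotMult` | `wallExclAddPotMult_of_lowerHalf_of_upperHalf` | LEAF K1 + OPEN `hUpM` + GZK |

`hUpM` / `hUpG` are the Euler-system (UPPER) half `MissingUpperBoundAt` on the cells (M) / (G-ord) in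
analytic rank `≤ 1` — the class-wide residual hypothesis `hUp` of `AltClosersAdditive.lean`, which
splits along the two cells WITHOUT LOSS (`upperHalf_n10_iff_cells`); `wallExclAdditive_of_cellLeaves`
reassembles row 2 from the six cell closers (so the cell split loses nothing against
`wallExclAdditive_of_leaves`).

§3 types the RANK / PRIME SLICES of row 2 that the wall's lane-3 planners carry as residual items
(HOME/bsd-wall-add/Sketch.lean: `RankZeroAdditive` = non-CM, `5 ≤ p`, additive, `r = 0`;
`AdditiveAtThree` = non-CM, additive at `3`, `r ≤ 1`; the rank-one slice), concluded VERBATIM in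
those shapes (no route file is imported) from the leaves: the rank-`0` slice at `p ≥ 5` needs only the
RANK-ZERO half `Additive.N10.LowerHalf` of K1, the leaves K8 / K9-tame and the rank-`0` upper half —
NO wild leaf (`ClassO6` forces `p = 3`); and on that slice the upper half is IN PRINT on the covered
locus of the tree's kernels (`X4RankZero.missingUpperBoundAt_of_facts_of_five_le_noL20`: X4 ∧ surj ∧
[`ord_p j < 0` ∨ (`p ∤ ∏ c_ℓ` ∧ a parametrisation with `p ∤ c`)], Kato 2004 Thm 14.5 (3) / 17.4 (3),
Delbourgo 1998 Prop 4; `AdditivePotMult.ClassX3M.missingUpperBoundAt_rankZero`: X3 ∧ pot-mult,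
Wuthrich 2014 Thm 16), so `upperHalfRankZero_n10_of_print_of_residual` names the rank-`0`, `p ≥ 5`
residual of rows 2a/2e relative to THAT chain: (irreducible NON-surjective image) ∪ ((G-ord) ∧
[reducible ∨ `p ∣ ∏ c_ℓ` ∨ every modular parametrisation has `p ∣ c`]) — the cell `bsd-addord`'s
component readings (`ClassX4Gord.missingUpperBoundAt_rankZero_of_katoComponent_of_surj`, Tamagawa-
and Manin-free on (G-ord, `e = 2`)) shrink it further and can be fed to the same slot. §4: the `p = 3`
slice of corner X7 (HOME/bsd-wall-ss/Sketch.lean residual `CornerX7AtThree`) from LEAF K3.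

References: WALL-BRIEF-v1.md §2 (row 2); CENSUS-EXCLUSIONS-v1.md §2 row 2, §3; LADDER-BSD.md §1c
(K1, K8, K9, K3 leaves); `WAll/TargetAdditive.lean`, `WAll/AltClosersAdditive.lean`,
`WAll/AltClosersGlue.lean`; `Additive/PotSupersingularClasses.lean`, `Additive/PotSupersingularTargets.lean`,
`Additive/N10LowerHalfStatements.lean`, `Additive/O7RankOneStatements.lean`,
`Additive/AdditiveOrdinaryLowerHalf.lean`, `Additive/X4RankZeroCoveredLocusFiveLeNoLemma20.lean`,
`AdditivePotMult/RankZeroChiBranchPrimeFacts.lean`.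
-/

noncomputable section

open scoped Classical

open WeierstrassCurve Literature.NumberTheory.EllipticCurves
  Literature.NumberTheory.EllipticCurves.Rank1Residual
  Literature.NumberTheory.EllipticCurves.Rank1Residual.Typed
  Literature.NumberTheory.EllipticCurves.Wuthrich2014
  Literature.NumberTheory.EllipticCurves.ModularForms

set_option autoImplicit false

namespace Summit.BirchSwinnertonDyer.Rank1Residual.WAll

open Summit.BirchSwinnertonDyer
open Additive

/-! ## §1 The six cell sub-`Prop`s of row 2 from the registered leaves -/

/-- **Row 2b ⇐ leaf K8 + GZK**: `O5SharpGss` (the typed missing `p`-part `MissingPPartAt` on the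
quadratic branch `(G) ∧ ss`, all curves, `r ≤ 1`) gives `WAllExclAddGss` (`bsdp_of_missingPPartAt`).
[folklore] -/
theorem wallExclAddGss_of_o5SharpGss (hK8 : O5SharpGss)
    (hGZK : rank_eq_analyticRank_of_analyticRank_le_one) : WAllExclAddGss :=
  fun W _ _ p _ _ hp hadd hs hr ↦ bsdp_of_missingPPartAt W p hGZK hr (hK8 W p hr hp hadd hs)

/-- **Row 2c ⇐ leaf K9-tame + GZK**: `O5SharpTprime` gives `WAllExclAddTprime`. [folklore] -/
theorem wallExclAddTprime_of_o5SharpTprime (hK9t : O5SharpTprime)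
    (hGZK : rank_eq_analyticRank_of_analyticRank_le_one) : WAllExclAddTprime :=
  fun W _ _ p _ _ hp hadd ht hr ↦ bsdp_of_missingPPartAt W p hGZK hr (hK9t W p hr hp hadd ht)

/-- **Rows 2b ∪ 2c (class O5) ⇐ leaves K8 + K9-tame + GZK** (through the cell's class target
`O5.Statement`: `o5Statement_of_sharpLeaves`, `wAllExclAddTameSS_of_statement`). [folklore] -/
theorem wallExclAddTameSS_of_sharpLeaves (hK8 : O5SharpGss) (hK9t : O5SharpTprime)
    (hGZK : rank_eq_analyticRank_of_analyticRank_le_one) : WAllExclAddTameSS :=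
  wAllExclAddTameSS_of_statement (o5Statement_of_sharpLeaves hK8 hK9t hGZK)

/-- **Row 2d (class O6, `p = 3`) ⇐ leaf K9-wild + GZK** (through `O6.Statement`:
`o6Statement_of_sharpLeaf`, `wAllExclAddWild_of_statement`). [folklore] -/
theorem wallExclAddWild_of_o6Sharp (hK9w : O6Sharp)
    (hGZK : rank_eq_analyticRank_of_analyticRank_le_one) : WAllExclAddWild :=
  wAllExclAddWild_of_statement (o6Statement_of_sharpLeaf hK9w hGZK)

/-- **Row 2a (cell (G-ord)) ⇐ leaf K1 + the UPPER half on (G-ord) + GZK.** `AdditiveOrdinaryLowerHalf`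
is the LOWER half `MissingLowerBoundAt` on `N10.Locus ⊇ (G-ord)` in rank `≤ 1`; `hUpG` is the
Euler-system half `MissingUpperBoundAt` on the cell (G-ord) (`SubGordOrd`) in rank `≤ 1` — OPEN
class-wide (in print on the rank-`0` covered locus only: §3); the two halves make `MissingPPartAt`,
and GZK converts to `BSDp`. [folklore] -/
theorem wallExclAddPotOrd_of_lowerHalf_of_upperHalf (hK1 : AdditiveOrdinaryLowerHalf)
    (hUpG : ∀ (W : WeierstrassCurve ℚ) [W.IsElliptic] [W.IsGloballyMinimal] (p : ℕ) [Fact p.Prime],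
      W.analyticRank ≤ 1 → p ≠ 2 → Addv W p → SubGordOrd W p → MissingUpperBoundAt W p)
    (hGZK : rank_eq_analyticRank_of_analyticRank_le_one) : WAllExclAddPotOrd :=
  fun W _ _ p _ _ hp hadd hG hr ↦
    bsdp_of_missingPPartAt W p hGZK hr
      (missingPPartAt_of_lower_of_upper W p (hK1 W p hr ⟨hp, hadd, Or.inr hG.2⟩)
        (hUpG W p hr hp hadd hG))

/-- **Row 2e (cell (M), potentially multiplicative) ⇐ leaf K1 + the UPPER half on (M) + GZK.**
`hUpM` is the Euler-system half on the cell (M) (`SubM`: `ord_p j < 0`) in rank `≤ 1` — OPEN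
class-wide (in print in rank `0` on X3(M) and on X4(M) ∧ surj: §3). [folklore] -/
theorem wallExclAddPotMult_of_lowerHalf_of_upperHalf (hK1 : AdditiveOrdinaryLowerHalf)
    (hUpM : ∀ (W : WeierstrassCurve ℚ) [W.IsElliptic] [W.IsGloballyMinimal] (p : ℕ) [Fact p.Prime],
      W.analyticRank ≤ 1 → p ≠ 2 → Addv W p → SubM W p → MissingUpperBoundAt W p)
    (hGZK : rank_eq_analyticRank_of_analyticRank_le_one) : WAllExclAddPotMult :=
  fun W _ _ p _ _ hp hadd hM hr ↦
    bsdp_of_missingPPartAt W p hGZK hr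
      (missingPPartAt_of_lower_of_upper W p (hK1 W p hr ⟨hp, hadd, Or.inl hM⟩)
        (hUpM W p hr hp hadd hM))

/-! ## §2 The upper half splits along the cells without loss; row 2 reassembled from the cell closers -/

/-- **`hUp` on `N10.Locus` = `hUpM` ∧ `hUpG`**: the K1 locus `p ≠ 2 ∧ Addv ∧ (PotMult ∨ TypeGOrd)` is
the union of the cells (M) (`SubM = PotMult`) and (G-ord) (`SubGordOrd = SubGord ∧ TypeGOrd`, with
`subGord_of_typeGOrd_of_addv`), so the class-wide upper-half hypothesis of
`wallExclAdditive_of_leaves` is exactly the conjunction of the two cell hypotheses of §1. [folklore] -/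
theorem upperHalf_n10_iff_cells :
    (∀ (W : WeierstrassCurve ℚ) [W.IsElliptic] [W.IsGloballyMinimal] (p : ℕ) [Fact p.Prime],
        W.analyticRank ≤ 1 → N10.Locus W p → MissingUpperBoundAt W p) ↔
      (∀ (W : WeierstrassCurve ℚ) [W.IsElliptic] [W.IsGloballyMinimal] (p : ℕ) [Fact p.Prime],
          W.analyticRank ≤ 1 → p ≠ 2 → Addv W p → SubM W p → MissingUpperBoundAt W p) ∧
        (∀ (W : WeierstrassCurve ℚ) [W.IsElliptic] [W.IsGloballyMinimal] (p : ℕ) [Fact p.Prime],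
          W.analyticRank ≤ 1 → p ≠ 2 → Addv W p → SubGordOrd W p → MissingUpperBoundAt W p) := by
  constructor
  · intro h
    exact ⟨fun W _ _ p _ hr hp hadd hM ↦ h W p hr ⟨hp, hadd, Or.inl hM⟩,
      fun W _ _ p _ hr hp hadd hG ↦ h W p hr ⟨hp, hadd, Or.inr hG.2⟩⟩
  · rintro ⟨hM, hG⟩ W _ _ p _ hr ⟨hp, hadd, h⟩
    rcases h with h | h
    · exact hM W p hr hp hadd h
    · exact hG W p hr hp hadd ⟨subGord_of_typeGOrd_of_addv W p hp h hadd, h⟩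

/-- **Row 2 ⇐ the six cell closers** (`wAllExclAdditive_iff_cells`): K1 + `hUpM` + `hUpG` + K8 +
K9-tame + K9-wild + GZK ⇒ `WAllExclAdditive` — the same inputs as `wallExclAdditive_of_leaves`
(`hUp` split by `upperHalf_n10_iff_cells`), assembled cell by cell. [folklore] -/
theorem wallExclAdditive_of_cellLeaves (hK1 : AdditiveOrdinaryLowerHalf)
    (hUpM : ∀ (W : WeierstrassCurve ℚ) [W.IsElliptic] [W.IsGloballyMinimal] (p : ℕ) [Fact p.Prime],
      W.analyticRank ≤ 1 → p ≠ 2 → Addv W p → SubM W p → MissingUpperBoundAt W p)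
    (hUpG : ∀ (W : WeierstrassCurve ℚ) [W.IsElliptic] [W.IsGloballyMinimal] (p : ℕ) [Fact p.Prime],
      W.analyticRank ≤ 1 → p ≠ 2 → Addv W p → SubGordOrd W p → MissingUpperBoundAt W p)
    (hK8 : O5SharpGss) (hK9t : O5SharpTprime) (hK9w : O6Sharp)
    (hGZK : rank_eq_analyticRank_of_analyticRank_le_one) : WAllExclAdditive :=
  wAllExclAdditive_iff_cells.2
    ⟨wallExclAddPotMult_of_lowerHalf_of_upperHalf hK1 hUpM hGZK,
      wallExclAddPotOrd_of_lowerHalf_of_upperHalf hK1 hUpG hGZK,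
      wallExclAddTameSS_of_sharpLeaves hK8 hK9t hGZK, wallExclAddWild_of_o6Sharp hK9w hGZK⟩

/-! ## §3 Rank and prime slices of row 2 (the lane-3 planners' residual shapes) from the leaves -/

/-- **Row 2 in rank `0` at `p ≥ 5`** (shape of the residual item `RankZeroAdditive` of the wall's
additive planner, verbatim: non-CM, `5 ≤ p`, additive, `r = 0` ⇒ `BSD(E,p)`) **⇐ the RANK-ZERO half
`N10.LowerHalf` of leaf K1 + the rank-`0` upper half on `N10.Locus` at `p ≥ 5` + leaves K8, K9-tame
+ GZK.** NO wild leaf: `ClassO6` forces `p = 3` (`ClassO6.p_eq_three`). (`AdditiveOrdinaryLowerHalf ↔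
N10.LowerHalf ∧ O7.LowerHalf`, `additiveOrdinaryLowerHalf_iff`.) [folklore] -/
theorem exclAdditiveRankZero_of_leaves (hN10 : N10.LowerHalf)
    (hUp0 : ∀ (W : WeierstrassCurve ℚ) [W.IsElliptic] [W.IsGloballyMinimal] (p : ℕ) [Fact p.Prime],
      W.analyticRank = 0 → 5 ≤ p → N10.Locus W p → MissingUpperBoundAt W p)
    (hK8 : O5SharpGss) (hK9t : O5SharpTprime)
    (hGZK : rank_eq_analyticRank_of_analyticRank_le_one) :
    ∀ (W : WeierstrassCurve ℚ) [W.IsElliptic] [W.IsGloballyMinimal] (p : ℕ) [Fact p.Prime],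
      ¬ W.HasCM → 5 ≤ p → Addv W p → W.analyticRank = 0 → BSDp W p := by
  intro W _ _ p _ _ hp5 hadd hr
  have hp2 : p ≠ 2 := by omega
  have hr' : W.analyticRank ≤ 1 := by omega
  rcases addv_odd_cells W p hp2 hadd with hM | hG | h5 | h6
  · exact bsdp_of_missingPPartAt W p hGZK hr'
      (missingPPartAt_of_lower_of_upper W p (hN10 W p hr ⟨hp2, hadd, Or.inl hM⟩)
        (hUp0 W p hr hp5 ⟨hp2, hadd, Or.inl hM⟩))
  · exact bsdp_of_missingPPartAt W p hGZK hr'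
      (missingPPartAt_of_lower_of_upper W p (hN10 W p hr ⟨hp2, hadd, Or.inr hG.2⟩)
        (hUp0 W p hr hp5 ⟨hp2, hadd, Or.inr hG.2⟩))
  · exact bsdp_of_missingPPartAt W p hGZK hr' (o5Sharp_iff.mpr ⟨hK8, hK9t⟩ W p hr' h5)
  · exact absurd (ClassO6.p_eq_three h6) (by omega)

/-- **The rank-`0`, `p ≥ 5` UPPER half on `N10.Locus` is IN PRINT on the covered locus; what is left
is a NAMED residual.** From the tree's kernels by name — `X4RankZero.missingUpperBoundAt_of_facts_of_five_le_noL20`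
(X4 ∧ `r = 0` ∧ surj(`p`) ∧ [`ord_p j < 0` ∨ (`p ∤ ∏ c_ℓ` ∧ ∃ parametrisation `D` with `p ∤ c_D`)];
print binders `hKatoS` Kato 2004 Thm 14.5 (3) sharp reading, `hDel` Delbourgo 1998 Prop 4, `hmodD`
modular parametrisation, `hKatoχ` Kato's half-eigen divisibility (Thm 17.4 (3) via Wuthrich 2014
Cor 19)) and `AdditivePotMult.ClassX3M.missingUpperBoundAt_rankZero` (X3 ∧ pot-mult ∧ `r = 0`, every
odd `p`; `hW16` Wuthrich 2014 Thm 16 half-eigen reading + `hDel`, `hmodD`), granted GZK and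
modularity — the upper half holds on all of `N10.Locus ∩ {r = 0, p ≥ 5}` as soon as it holds on the
RESIDUAL `hRes`: [`E[p]` irreducible with NON-surjective `ρ̄_{E,p}`] ∪ [not potentially multiplicative
(so (G-ord)) ∧ (`E[p]` reducible ∨ `p ∣ ∏ c_ℓ` ∨ every modular parametrisation has `p ∣ c`)]. The
residual is relative to THIS chain (the cell `bsd-addord`'s component readings on (G-ord, `e = 2`)
are Tamagawa- and Manin-free and shrink it further). [folklore] -/
theorem upperHalfRankZero_n10_of_print_of_residual
    (hKatoS : Kato2004.rankZero_padicValNat_sha_le_sub_localTamagawa_of_additive_potGood_of_imageContainsSL2)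
    (hDel : Delbourgo1998.prop4_rankZero_pow_dvd_constantCoeff)
    (hmodD : nonempty_modularParametrizationData)
    (hKatoχ : Wuthrich2014.kato_halfEigenCharIdeal_dvd_cyclotomicPrime_of_surjective)
    (hW16 : Wuthrich2014.thm16_halfEigenCharIdeal_dvd_cyclotomicPrime)
    (hGZK : rank_eq_analyticRank_of_analyticRank_le_one) (hmod : hasEntireLFunction_rat)
    (hRes : ∀ (W : WeierstrassCurve ℚ) [W.IsElliptic] [W.IsGloballyMinimal] (p : ℕ) [Fact p.Prime],
      W.analyticRank = 0 → 5 ≤ p → N10.Locus W p →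
      (Irr W p ∧ ¬ Surj W p) ∨
        (¬ PotMult W p ∧ (Red W p ∨ p ∣ W.tamagawaProduct ∨
          ∀ (N : ℕ) [NeZero N] (D : ModularParametrizationData W N), (p : ℤ) ∣ D.maninConstant)) →
      MissingUpperBoundAt W p) :
    ∀ (W : WeierstrassCurve ℚ) [W.IsElliptic] [W.IsGloballyMinimal] (p : ℕ) [Fact p.Prime],
      W.analyticRank = 0 → 5 ≤ p → N10.Locus W p → MissingUpperBoundAt W p := by
  intro W _ _ p _ hr hp5 hL
  have hp2 : p ≠ 2 := hL.1
  have hadd : Addv W p := hL.2.1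
  by_cases hM : PotMult W p
  · -- cell (M): X3(M) by Wuthrich Thm 16; X4(M) ∧ surj by Kato/Delbourgo; X4(M) ∧ ¬surj residual
    by_cases hirr : Irr W p
    · by_cases hs : Surj W p
      · exact X4RankZero.missingUpperBoundAt_of_facts_of_five_le_noL20 W p hKatoS hDel hGZK hmod
          hmodD hKatoχ hp5 hr ⟨hp2, hadd, hirr⟩ hs (Or.inl hM)
      · exact hRes W p hr hp5 hL (Or.inl ⟨hirr, hs⟩)
    · exact AdditivePotMult.ClassX3M.missingUpperBoundAt_rankZero hDel hGZK hmod hmodD hW16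
        ⟨⟨hirr, hadd⟩, ⟨hadd, hM⟩, hp2⟩ hr
  · -- cell (G-ord): X4 ∧ surj ∧ p ∤ ∏ c_ℓ ∧ (∃ D, p ∤ c_D) by Kato; the rest residual
    by_cases hirr : Irr W p
    · by_cases hs : Surj W p
      · by_cases htam : p ∣ W.tamagawaProduct
        · exact hRes W p hr hp5 hL (Or.inr ⟨hM, Or.inr (Or.inl htam)⟩)
        · by_cases hD : ∃ (N : ℕ) (_ : NeZero N) (D : ModularParametrizationData W N),
            ¬ (p : ℤ) ∣ D.maninConstant
          · exact X4RankZero.missingUpperBoundAt_of_facts_of_five_le_noL20 W p hKatoS hDel hGZK hmod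
              hmodD hKatoχ hp5 hr ⟨hp2, hadd, hirr⟩ hs (Or.inr ⟨htam, hD⟩)
          · refine hRes W p hr hp5 hL (Or.inr ⟨hM, Or.inr (Or.inr ?_)⟩)
            intro N _ D
            by_contra hc
            exact hD ⟨N, ‹NeZero N›, D, hc⟩
      · exact hRes W p hr hp5 hL (Or.inl ⟨hirr, hs⟩)
    · exact hRes W p hr hp5 hL (Or.inr ⟨hM, Or.inl hirr⟩)

/-- **Row 2 in rank `0` at `p ≥ 5` ⇐ `N10.LowerHalf` (K1, rank-`0` half) + leaves K8, K9-tame + the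
PRINT binders of `upperHalfRankZero_n10_of_print_of_residual` + its NAMED residual `hRes` + GZK +
modularity** — the registry closer of the `RankZeroAdditive` shape with the covered locus discharged
in print. [folklore] -/
theorem exclAdditiveRankZero_of_leaves_of_print_of_residual (hN10 : N10.LowerHalf)
    (hK8 : O5SharpGss) (hK9t : O5SharpTprime)
    (hKatoS : Kato2004.rankZero_padicValNat_sha_le_sub_localTamagawa_of_additive_potGood_of_imageContainsSL2)
    (hDel : Delbourgo1998.prop4_rankZero_pow_dvd_constantCoeff)
    (hmodD : nonempty_modularParametrizationData)
    (hKatoχ : Wuthrich2014.kato_halfEigenCharIdeal_dvd_cyclotomicPrime_of_surjective)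
    (hW16 : Wuthrich2014.thm16_halfEigenCharIdeal_dvd_cyclotomicPrime)
    (hGZK : rank_eq_analyticRank_of_analyticRank_le_one) (hmod : hasEntireLFunction_rat)
    (hRes : ∀ (W : WeierstrassCurve ℚ) [W.IsElliptic] [W.IsGloballyMinimal] (p : ℕ) [Fact p.Prime],
      W.analyticRank = 0 → 5 ≤ p → N10.Locus W p →
      (Irr W p ∧ ¬ Surj W p) ∨
        (¬ PotMult W p ∧ (Red W p ∨ p ∣ W.tamagawaProduct ∨
          ∀ (N : ℕ) [NeZero N] (D : ModularParametrizationData W N), (p : ℤ) ∣ D.maninConstant)) →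
      MissingUpperBoundAt W p) :
    ∀ (W : WeierstrassCurve ℚ) [W.IsElliptic] [W.IsGloballyMinimal] (p : ℕ) [Fact p.Prime],
      ¬ W.HasCM → 5 ≤ p → Addv W p → W.analyticRank = 0 → BSDp W p :=
  exclAdditiveRankZero_of_leaves hN10
    (upperHalfRankZero_n10_of_print_of_residual hKatoS hDel hmodD hKatoχ hW16 hGZK hmod hRes) hK8 hK9t
    hGZK

/-- **Row 2 in rank `1` at `p ≥ 5`** (non-CM, `5 ≤ p`, additive, `r = 1` ⇒ `BSD(E,p)`; the wall's
additive planner's off-`♯` residual `OffSharpRankOneAdditive` is this shape with one more hypothesis,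
hence follows by weakening) **⇐ the RANK-ONE half `O7.LowerHalf` of leaf K1 + the rank-`1` upper
half on `N10.Locus` at `p ≥ 5` (OPEN class-wide: `Additive/O7RankOneStatements.lean` §3) + leaves
K8, K9-tame + GZK.** No wild leaf (`p = 3` only). [folklore] -/
theorem exclAdditiveRankOne_of_leaves (hO7 : O7.LowerHalf)
    (hUp1 : ∀ (W : WeierstrassCurve ℚ) [W.IsElliptic] [W.IsGloballyMinimal] (p : ℕ) [Fact p.Prime],
      W.analyticRank = 1 → 5 ≤ p → N10.Locus W p → MissingUpperBoundAt W p)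
    (hK8 : O5SharpGss) (hK9t : O5SharpTprime)
    (hGZK : rank_eq_analyticRank_of_analyticRank_le_one) :
    ∀ (W : WeierstrassCurve ℚ) [W.IsElliptic] [W.IsGloballyMinimal] (p : ℕ) [Fact p.Prime],
      ¬ W.HasCM → 5 ≤ p → Addv W p → W.analyticRank = 1 → BSDp W p := by
  intro W _ _ p _ _ hp5 hadd hr
  have hp2 : p ≠ 2 := by omega
  have hr' : W.analyticRank ≤ 1 := by omega
  rcases addv_odd_cells W p hp2 hadd with hM | hG | h5 | h6
  · exact bsdp_of_missingPPartAt W p hGZK hr'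
      (missingPPartAt_of_lower_of_upper W p (hO7 W p hr ⟨hp2, hadd, Or.inl hM⟩)
        (hUp1 W p hr hp5 ⟨hp2, hadd, Or.inl hM⟩))
  · exact bsdp_of_missingPPartAt W p hGZK hr'
      (missingPPartAt_of_lower_of_upper W p (hO7 W p hr ⟨hp2, hadd, Or.inr hG.2⟩)
        (hUp1 W p hr hp5 ⟨hp2, hadd, Or.inr hG.2⟩))
  · exact bsdp_of_missingPPartAt W p hGZK hr' (o5Sharp_iff.mpr ⟨hK8, hK9t⟩ W p hr' h5)
  · exact absurd (ClassO6.p_eq_three h6) (by omega)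

/-- **Row 2 at `p ≥ 5`, both ranks, from the two rank slices** (bookkeeping `r ≤ 1 ↔ r = 0 ∨ r = 1`):
the `p ≥ 5` part of `WAllExclAdditive`. [folklore] -/
theorem exclAdditiveFiveLe_of_rankSlices
    (h0 : ∀ (W : WeierstrassCurve ℚ) [W.IsElliptic] [W.IsGloballyMinimal] (p : ℕ) [Fact p.Prime],
      ¬ W.HasCM → 5 ≤ p → Addv W p → W.analyticRank = 0 → BSDp W p)
    (h1 : ∀ (W : WeierstrassCurve ℚ) [W.IsElliptic] [W.IsGloballyMinimal] (p : ℕ) [Fact p.Prime],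
      ¬ W.HasCM → 5 ≤ p → Addv W p → W.analyticRank = 1 → BSDp W p) :
    ∀ (W : WeierstrassCurve ℚ) [W.IsElliptic] [W.IsGloballyMinimal] (p : ℕ) [Fact p.Prime],
      ¬ W.HasCM → 5 ≤ p → Addv W p → W.analyticRank ≤ 1 → BSDp W p := by
  intro W _ _ p _ hcm hp5 hadd hr
  rcases Nat.le_one_iff_eq_zero_or_eq_one.mp hr with h | h
  · exact h0 W p hcm hp5 hadd h
  · exact h1 W p hcm hp5 hadd h

/-- **Row 2 at `p = 3`** (shape of the residual item `AdditiveAtThree` of the wall's additive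
planner, verbatim: non-CM, additive at `3`, `r ≤ 1` ⇒ `BSD(E,3)`) **⇐ leaf K1 + the upper half on
`N10.Locus` at `3` + leaves K8, K9-tame, K9-wild + GZK** — all four cells occur at `3` ((M), (G-ord)
with `e = 2`, tame pot-supersingular, wild). The rung-W2 leaf `N11.KimAtThreeRankZeroPUB` closes rows
here PER PAIR only (`N11.bsdp_three_of_kimAtThreeRankZeroPUB_of_kuriharaUnitAt`), not class-wide.
[folklore] -/
theorem exclAdditiveAtThree_of_leaves (hK1 : AdditiveOrdinaryLowerHalf)
    (hUp3 : ∀ (W : WeierstrassCurve ℚ) [W.IsElliptic] [W.IsGloballyMinimal],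
      W.analyticRank ≤ 1 → N10.Locus W 3 → MissingUpperBoundAt W 3)
    (hK8 : O5SharpGss) (hK9t : O5SharpTprime) (hK9w : O6Sharp)
    (hGZK : rank_eq_analyticRank_of_analyticRank_le_one) :
    ∀ (W : WeierstrassCurve ℚ) [W.IsElliptic] [W.IsGloballyMinimal],
      ¬ W.HasCM → Addv W 3 → W.analyticRank ≤ 1 → BSDp W 3 := by
  intro W _ _ _ hadd hr
  have h32 : (3 : ℕ) ≠ 2 := by decide
  rcases addv_odd_cells W 3 h32 hadd with hM | hG | h5 | h6
  · exact bsdp_of_missingPPartAt W 3 hGZK hr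
      (missingPPartAt_of_lower_of_upper W 3 (hK1 W 3 hr ⟨h32, hadd, Or.inl hM⟩)
        (hUp3 W hr ⟨h32, hadd, Or.inl hM⟩))
  · exact bsdp_of_missingPPartAt W 3 hGZK hr
      (missingPPartAt_of_lower_of_upper W 3 (hK1 W 3 hr ⟨h32, hadd, Or.inr hG.2⟩)
        (hUp3 W hr ⟨h32, hadd, Or.inr hG.2⟩))
  · exact bsdp_of_missingPPartAt W 3 hGZK hr (o5Sharp_iff.mpr ⟨hK8, hK9t⟩ W 3 hr h5)
  · exact bsdp_of_missingPPartAt W 3 hGZK hr (hK9w W 3 hr h6)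

/-- **Row 2 from its `p = 3` and `p ≥ 5` parts** (an odd prime is `3` or `≥ 5`): the prime split of
`WAllExclAdditive` loses nothing. [folklore] -/
theorem wallExclAdditive_of_three_of_fiveLe
    (h3 : ∀ (W : WeierstrassCurve ℚ) [W.IsElliptic] [W.IsGloballyMinimal],
      ¬ W.HasCM → Addv W 3 → W.analyticRank ≤ 1 → BSDp W 3)
    (h5 : ∀ (W : WeierstrassCurve ℚ) [W.IsElliptic] [W.IsGloballyMinimal] (p : ℕ) [Fact p.Prime],
      ¬ W.HasCM → 5 ≤ p → Addv W p → W.analyticRank ≤ 1 → BSDp W p) :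
    WAllExclAdditive := by
  intro W _ _ p _ hcm hp2 hadd hr
  by_cases hp3 : p = 3
  · subst hp3
    exact h3 W hcm hadd hr
  · exact h5 W p hcm ((Fact.out : p.Prime).five_le_of_ne_two_of_ne_three hp2 hp3) hadd hr

/-- Conversely each slice follows from `WAllExclAdditive` (so the slices are exactly row 2). [folklore] -/
theorem slices_of_wallExclAdditive (h : WAllExclAdditive) :
    (∀ (W : WeierstrassCurve ℚ) [W.IsElliptic] [W.IsGloballyMinimal],
        ¬ W.HasCM → Addv W 3 → W.analyticRank ≤ 1 → BSDp W 3) ∧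
      (∀ (W : WeierstrassCurve ℚ) [W.IsElliptic] [W.IsGloballyMinimal] (p : ℕ) [Fact p.Prime],
        ¬ W.HasCM → 5 ≤ p → Addv W p → W.analyticRank = 0 → BSDp W p) ∧
      (∀ (W : WeierstrassCurve ℚ) [W.IsElliptic] [W.IsGloballyMinimal] (p : ℕ) [Fact p.Prime],
        ¬ W.HasCM → 5 ≤ p → Addv W p → W.analyticRank = 1 → BSDp W p) :=
  ⟨fun W _ _ hcm hadd hr ↦ h W 3 hcm (by decide) hadd hr,
    fun W _ _ p _ hcm hp5 hadd hr ↦ h W p hcm (by omega) hadd (by omega),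
    fun W _ _ p _ hcm hp5 hadd hr ↦ h W p hcm (by omega) hadd (by omega)⟩

/-! ## §4 The `p = 3` slice of corner X7 (the wall's supersingular planner's residual shape) -/

/-- **Corner X7 at `p = 3`** (shape of the residual item `CornerX7AtThree` of the wall's
signed-Selmer planner, verbatim: `p = 3`, non-CM, `ClassX7 W p`, `r ≤ 1` ⇒ `BSD(E,p)`) **⇐ leaf K3
`Supersingular.SignedSupersingular` + Wuthrich + GZK + modularity** (`wallCornerX7_of_signedSupersingular`
at `p = 3`). [folklore] -/
theorem cornerX7AtThree_of_signedSupersingular (hS : Supersingular.SignedSupersingular)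
    (hW : sha_dvd_analyticSha) (hGZK : rank_eq_analyticRank_of_analyticRank_le_one)
    (hmod : hasEntireLFunction_rat) :
    ∀ (W : WeierstrassCurve ℚ) [W.IsElliptic] [W.IsGloballyMinimal] (p : ℕ) [Fact p.Prime],
      p = 3 → ¬ W.HasCM → ClassX7 W p → W.analyticRank ≤ 1 → BSDp W p :=
  fun W _ _ p _ hp3 hcm hX hr ↦
    wallCornerX7_of_signedSupersingular hS hW hGZK hmod W p hcm (by omega) hX hr

/-- **Corner X7 from its `p = 3` and `p ≥ 5` parts** (the prime split of `WAllCornerX7` loses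
nothing). [folklore] -/
theorem wallCornerX7_of_three_of_fiveLe
    (h3 : ∀ (W : WeierstrassCurve ℚ) [W.IsElliptic] [W.IsGloballyMinimal] (p : ℕ) [Fact p.Prime],
      p = 3 → ¬ W.HasCM → ClassX7 W p → W.analyticRank ≤ 1 → BSDp W p)
    (h5 : ∀ (W : WeierstrassCurve ℚ) [W.IsElliptic] [W.IsGloballyMinimal] (p : ℕ) [Fact p.Prime],
      5 ≤ p → ¬ W.HasCM → ClassX7 W p → W.analyticRank ≤ 1 → BSDp W p) :
    WAllCornerX7 := by
  intro W _ _ p _ hcm hp2 hX hr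
  by_cases hp3 : p = 3
  · exact h3 W p hp3 hcm hX hr
  · exact h5 W p ((Fact.out : p.Prime).five_le_of_ne_two_of_ne_three hp2 hp3) hcm hX hr

end Summit.BirchSwinnertonDyer.Rank1Residual.WAll

end
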